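import Literature.AnabelianGeometry.EtaleTheta.BiKummerRootTwist
import Literature.AnabelianGeometry.EtaleTheta.BiKummerOfModelCanonical
import Literature.AlgebraicGeometry.Frobenioids.ModelFrobenioidPreSteps

/-!
# [EtTh] §4 / Rmk 4.3.2: the `N`-th power law of the twisted root at the canonical model — the binder `hpow` of
# `NthRoot.twistUnit` DISCHARGED from `ũ ≫ β = β ≫ u` ([FrdI] Thm 5.2 (i) unit bookkeeping along the degree-`N` isometry `β`)

S. Mochizuki, *The étale theta function and its Frobenioid-theoretic manifestations*, Publ. RIMS **45** (2009)
[cite: MochizukiEtTh2009, Prop 4.2 (iii) p.314 (PDF p.88); Rmk 4.3.2 p.318–319 (PDF pp.92–93); Lem 5.8 p.331 (PDF p.105)];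
S. Mochizuki, *The geometry of Frobenioids I*, [FrdI] Thm. 5.2 (i)(ii) pp.100–101 (morphisms of the model Frobenioid:
`u_{ψ∘φ} = Base(φ)^* u_ψ · u_φ^{deg_Fr ψ}`).

abc-iut cell, layer L2, row R192 sequel (2b) (seat abc-iut-f-121; spec abc-iut-L2-d4 10:13:09Z).  PROOF-ONLY over
`BiKummerRootTwist.lean` (p437955) and abc-iut-L2-t9's `BiKummerOfModelCanonical.lean`.

WHAT IS PROVED (`pow_twistRoot_eq_pullFracModel`).  At the canonical model `mkOfModelCanonical` (`O^×(A^birat) = B(A_D)^×`,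
`s′·(s″)⁻¹ = u_{s′}·u_{s″}⁻¹`, `((φ)^birat)^* = B(Base φ)`), for an `N`-th root
`R = (A_N, B_N, α = α″ ≫ α′, β, f_N, (s′_N, s″_N))` of `(s′, s″)` and units `u ∈ O^×(B)`, `ũ ∈ O^×(B_N)` with `ũ ≫ β = β ≫ u`:
  `(s′_N·(ũ ∘ s″_N)⁻¹)^N = (α′)^* (s′·(u ∘ s″)⁻¹)`,
i.e. the twisted root `f′_N` IS an `N`-th root of the pull-back of the twisted function `f′` — the binder `hpow` of
`NthRoot.twistUnit` holds at the model.  Mechanism ([FrdI] Thm 5.2 (i)): reading the units of `ũ ≫ β = β ≫ u` gives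
`u_ũ^N = Base(β)^* u_u` (`deg_Fr β = N`, `deg_Fr u = 1`, `Base ũ = id`, cancel the unit `u_β`), and the square
`s″_N ≫ β = α ≫ s″` with `Base α = Base α′` (`α″` base-identity) transports it to `A_N`.  Together with
`Discharge/Sec4RootTwistLaws.lean` (p438735: `hdisj`, `hsat ⟸ fixedness`, the fraction laws) this leaves, of the binders of
`NthRoot.twistUnit`, exactly the EXISTENCE of the unit `ũ` over `u` and the `H_{A_N}`-fixedness of `(α′)^* f′` (abc-iut-L2-d4's
`hroot₁N`; print: the twisting unit is a constant, Lemma 5.8).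
HONEST FRAMING: a kernel-checked identity in the model vocabulary; refereed pre-IUT material; nothing here bears on
[IUTchIII] Cor. 3.12 or takes a side; typed ≠ proved for any genuine datum.
-/

namespace Literature.AnabelianGeometry.EtaleTheta

open CategoryTheory Opposite Literature.AlgebraicGeometry.Frobenioids

namespace BiKummerSetting

universe u₀ v₀ u v w

variable {K : Type u₀} [Field K] {D₀ : Type u₀} [Category.{v₀} D₀] {V : FrdIMonoidStub.{w}}
  (X : SemiGraphs.TemperedArithmeticGroup.{u₀} K) {T : RealifiedDivisorMonoids (D₀ := D₀) V}
  {D : Type u} [Category.{v} D] {VD : FrdICatStub.{u, v, w} D}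
  (tf : TemperedFrobenioid T D VD) (hZ : tf.monoidType = MonoidType.Z)
  (hP : ∀ A : Dᵒᵖ, IsPerfect (tf.Φ.carrier A)) (IG : D → Prop) (gS : ∀ A : D, IG A → (X.Pi →* Aut A))
  (gSs : ∀ (A : D) (h : IG A), Function.Surjective (gS A h))
  (NH : Subgroup (Field.absoluteGaloisGroup K) → tf.category → ℕ+ → Prop) (A₀ : tf.category)
  (hA₀ : PreFrobenioid.IsFrobeniusTrivial tf.toElem A₀) (hA₀' : IG A₀.base)

/-- **[FrdI] Thm 5.2 (i) along `ũ ≫ β = β ≫ u`: `u_ũ^N = Base(β)^* u_u`** for units `u ∈ O^×(B)`, `ũ ∈ O^×(B_N)` and a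
morphism `β : B_N → B` of Frobenius degree `N` (the unit `u_β` cancels in the group-like `B(B_{N,D})`).
[cite: MochizukiEtTh2009, Rmk 4.3.2 p.319 (PDF p.93)] -/
theorem unit_pow_eq_pull_of_over {BN B : tf.category} (β : BN ⟶ B) {N : ℕ+} (hβ : ModelFrobenioid.degFr β = N)
    (u : Aut B) (hu : u ∈ ModelFrobenioid.units B) (ut : Aut BN) (hut : ut ∈ ModelFrobenioid.units BN)
    (hover : ut.hom ≫ β = β ≫ u.hom) :
    ModelFrobenioid.unit ut.hom ^ (N : ℕ) = pull tf.ratFnFunctor (ModelFrobenioid.baseMap β) (ModelFrobenioid.unit u.hom) := by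
  have e := congrArg ModelFrobenioid.unit hover
  rw [ModelFrobenioid.unit_comp_pull, ModelFrobenioid.unit_comp_pull, ModelFrobenioid.pull_baseMap_of_mem_units hut, hβ,
    hu.2, PNat.one_coe, pow_one, mul_comm] at e
  exact (tf.isUnit_ratFnFunctor T.isUnit_BΛ BN (ModelFrobenioid.unit β)).mul_right_cancel e

/-- **The binder `hpow` of `NthRoot.twistUnit` HOLDS at the canonical model**: for an `N`-th root `R` of `(s′, s″)` (transport
`pullFrac := B(Base −)`), units `u ∈ O^×(B)`, `ũ ∈ O^×(B_N)` with `ũ ≫ β = β ≫ u`: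
`(s′_N·(ũ ∘ s″_N)⁻¹)^N = (α′)^* (s′·(u ∘ s″)⁻¹)` in `O^×(A_N^birat)`.
[cite: MochizukiEtTh2009, Prop 4.2 (iii) p.314 (PDF p.88); Rmk 4.3.2 p.318–319 (PDF pp.92–93)] -/
theorem pow_twistRoot_eq_pullFracModel {A B : tf.category}
    {f : (mkOfModelCanonical X tf hZ hP IG gS gSs NH A₀ hA₀ hA₀').biratUnits A}
    {P : (mkOfModelCanonical X tf hZ hP IG gS gSs NH A₀ hA₀ hA₀').FractionPair f B} {N : ℕ+}
    (R : (mkOfModelCanonical X tf hZ hP IG gS gSs NH A₀ hA₀ hA₀').NthRoot f P N (fun {_} φ x => tf.pullFracModel φ x))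
    (u : Aut B) (hu : u ∈ ModelFrobenioid.units B) (ut : Aut R.BN) (hut : ut ∈ ModelFrobenioid.units R.BN)
    (hover : ut.hom ≫ R.β = R.β ≫ u.hom) :
    tf.fracOfModel T.isUnit_BΛ R.pair.num (R.pair.den ≫ ut.hom) ^ (N : ℕ) =
      tf.pullFracModel R.αData.α₁ (tf.fracOfModel T.isUnit_BΛ P.num (P.den ≫ u.hom)) := by
  -- the units `c := (s″)^* u_u`, `c_N := (s″_N)^* u_ũ` by which the twists divide the fractions
  set c := (tf.isUnit_ratFnFunctor T.isUnit_BΛ A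
    (pull tf.ratFnFunctor (ModelFrobenioid.baseMap P.den) (ModelFrobenioid.unit u.hom))).unit with hc
  set cN := (tf.isUnit_ratFnFunctor T.isUnit_BΛ R.AN
    (pull tf.ratFnFunctor (ModelFrobenioid.baseMap R.pair.den) (ModelFrobenioid.unit ut.hom))).unit with hcN
  have hf : tf.fracOfModel T.isUnit_BΛ P.num P.den = f := P.frac_eq
  have hr : tf.fracOfModel T.isUnit_BΛ R.pair.num R.pair.den = R.root := R.pair.frac_eq
  have hf' : tf.fracOfModel T.isUnit_BΛ P.num (P.den ≫ u.hom) * c = f :=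
    (ModelFrobenioid.frac_comp_unit_mul _ P.num P.den hu).trans hf
  have hr' : tf.fracOfModel T.isUnit_BΛ R.pair.num (R.pair.den ≫ ut.hom) * cN = R.root :=
    (ModelFrobenioid.frac_comp_unit_mul _ R.pair.num R.pair.den hut).trans hr
  -- the key identity `c_N^N = (α′)^* c`
  have hβ : ModelFrobenioid.degFr R.β = N := R.isIsometry.2.2.2
  have hbaseα : ModelFrobenioid.baseMap R.α = ModelFrobenioid.baseMap R.αData.α₁ := by
    rw [← congrArg ModelFrobenioid.baseMap R.αData.fac, ModelFrobenioid.baseMap_comp,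
      show ModelFrobenioid.baseMap R.αData.α₂ = 𝟙 _ from R.αData.cond_c.1, Category.id_comp]
  have key : cN ^ (N : ℕ) = tf.pullFracModel R.αData.α₁ c := by
    apply Units.ext
    rw [Units.val_pow_eq_pow_val, hcN, IsUnit.unit_spec, TemperedFrobenioid.coe_pullFracModel_apply, hc, IsUnit.unit_spec,
      ← map_pow, unit_pow_eq_pull_of_over tf R.β hβ u hu ut hut hover, ← pull_comp, ← ModelFrobenioid.baseMap_comp,
      R.comm_den, ModelFrobenioid.baseMap_comp, hbaseα, pull_comp]
    rfl
  have hpow0 : (R.root : tf.biratUnitsModel R.AN) ^ (N : ℕ) = tf.pullFracModel R.αData.α₁ f := R.pow_root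
  rw [eq_mul_inv_of_mul_eq hf', eq_mul_inv_of_mul_eq hr', mul_pow, inv_pow, key, map_mul, map_inv]
  exact congrArg (fun t => t * (tf.pullFracModel R.αData.α₁ c)⁻¹) hpow0

/-! ### The same law for a root typed over ANY rendering of the birational pull-back (abc-iut-L2-d4 11:50:03Z) -/

/-- **The `N`-th power law of the twisted root, for a root typed over a GENERIC transport `pullFrac` that AGREES with
`pullFracModel`** (`hF`, the «any rendering agreeing with `pullFracModel`» shape of
`ThetaFrobenioid.thetaPairIsRoot_ofConnectedTemperoidData_of_pullFracModel`): for an `N`-th root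
`R = (A_N, B_N, α = α″ ≫ α′, β, f_N, (s′_N, s″_N))` of `(s′, s″)` at the canonical model, units `u ∈ O^×(B)`, `ũ ∈ O^×(B_N)` with
`ũ ≫ β = β ≫ u`:  `(s′_N·(ũ ∘ s″_N)⁻¹)^N = pullFrac α′ (s′·(u ∘ s″)⁻¹)` — the binder `hpow` of `NthRoot.twistUnit` for roots whose
`pullFrac` is a variable (abc-iut-L2-d4's tower roots; at the level-`N` root REBASED over the level-`1` pair along `β_{1,N}`,
`BiKummerRootRebase.lean`, this is the `hpow` input of `NthRoot.exists_unit_transport_twisted_rebase` with `α′ := D_N.α₁`).  Proof: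
the root re-typed over `pullFracModel` along `hF`, then `pow_twistRoot_eq_pullFracModel`.
[cite: MochizukiEtTh2009, Prop 4.2 (iii) p.314 (PDF p.88); Rmk 4.3.2 p.318–319 (PDF pp.92–93)] -/
theorem pow_twistRoot_eq_pullFrac_of_rendering {A B : tf.category}
    {pullFrac : ∀ {A A' : (mkOfModelCanonical X tf hZ hP IG gS gSs NH A₀ hA₀ hA₀').C} (_ : A' ⟶ A),
      (mkOfModelCanonical X tf hZ hP IG gS gSs NH A₀ hA₀ hA₀').biratUnits A →
        (mkOfModelCanonical X tf hZ hP IG gS gSs NH A₀ hA₀ hA₀').biratUnits A'}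
    (hF : ∀ {A A' : (mkOfModelCanonical X tf hZ hP IG gS gSs NH A₀ hA₀ hA₀').C} (ψ : A' ⟶ A)
      (y : (mkOfModelCanonical X tf hZ hP IG gS gSs NH A₀ hA₀ hA₀').biratUnits A), pullFrac ψ y = tf.pullFracModel ψ y)
    {f : (mkOfModelCanonical X tf hZ hP IG gS gSs NH A₀ hA₀ hA₀').biratUnits A}
    {P : (mkOfModelCanonical X tf hZ hP IG gS gSs NH A₀ hA₀ hA₀').FractionPair f B} {N : ℕ+}
    (R : (mkOfModelCanonical X tf hZ hP IG gS gSs NH A₀ hA₀ hA₀').NthRoot f P N pullFrac)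
    (u : Aut B) (hu : u ∈ ModelFrobenioid.units B) (ut : Aut R.BN) (hut : ut ∈ ModelFrobenioid.units R.BN)
    (hover : ut.hom ≫ R.β = R.β ≫ u.hom) :
    tf.fracOfModel T.isUnit_BΛ R.pair.num (R.pair.den ≫ ut.hom) ^ (N : ℕ) =
      pullFrac R.αData.α₁ (tf.fracOfModel T.isUnit_BΛ P.num (P.den ≫ u.hom)) := by
  rw [hF]
  exact pow_twistRoot_eq_pullFracModel X tf hZ hP IG gS gSs NH A₀ hA₀ hA₀'
    { R with
      pow_root := by simpa only [hF] using R.pow_root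
      isSaturated := by simpa only [hF] using R.isSaturated } u hu ut hut hover

end BiKummerSetting

end Literature.AnabelianGeometry.EtaleTheta
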